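import Mathlib
import HarnessLib
import Summits.ResolutionOfSingularities.ResolutionOfSingularities.Theorems.HomologicalConductorPersistenceKC3JacobianFloorDefs

/-!
# K-SD0 branch (ii) SD-K1 — the deformed normalisations `A_u = k[a⁶ + u·abc, b³, c²]`, II: `W₀ = k[a,b,c]^{μ₆(1,2,3)}`
# is FREE of rank 6 over every `A_u` on the box monomials (chain W4.4b, seat res-L1-w44b-stub-4 gen 5; kernel half
# of «b³c² ∈ ca⁴(T₁)», CHAIN v13.13 §V13.21.8)

[OURS · L1 w44b · K-SD0 stmt-16485 / rung S-2] Nothing here is a statement of the manuscript under review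
(Hironaka 2017); AI-written, weaker than expert review.

Continues `…KC3JacobianFloorDefs.lean` (`θu`, `kc3Au`, the `A_u`-algebra structure on `W₀`, triangularity).
This is the instance the Noether-different floor `𝔑(W₀/A_u) ⊆ ca⁴(W₀)` needs (`W₀` PROJECTIVE over `A_u`) —
Hironaka's «Cohen–Macaulay ⇒ free over every homogeneous system of parameters» for THIS ring and THIS
one-parameter family of parameters, by leading terms instead of depth:

* `coordAu u : (Fin 6 → A_u) →ₗ W₀`, `f ↦ Σᵢ fᵢ • mᵢ` (`mᵢ = 1, a⁴b, a²b², a³c, abc, a⁵b²c`);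
* `eq_zero_of_sum_θu_mul_box_eq_zero` — INDEPENDENCE: `Σᵢ θ_u(gᵢ)·x^{box i} = 0 ⇒ g = 0` (the pair `(i, q)`,
  `q ∈ supp gᵢ`, with `box i + sc q` of largest `a`-degree is hit by exactly one term, with coefficient
  `coeff_q gᵢ`: triangularity + res-D-pv-037's `box_add_sc_injective`); `θu_injective`; `coordAu_injective`;
* `monomial_mem_range_coordAu` — SPANNING by induction on the `a`-degree (`a⁶ = θ_u(A) − u·abc` lowers it);
  `coordAu_surjective`;
* **`kc3BasisAu u : Module.Basis (Fin 6) ↥(kc3Au u) ↥(kc3W k)`**, instances `kc3W.moduleFreeAu`,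
  `kc3W.moduleFiniteAu`, `kc3θuEquiv u : k[A,B,C] ≃ₐ[k] ↥(kc3Au u)`, `kc3Au.isNoetherianRing`.

References: Hochster–Eagon (1971) / Hironaka's freeness criterion, folklore; res-D-pv-037's
`…KC3FrobeniusOrderBasis` (the case `u = 0`, whose bookkeeping `box`/`sc`/`rem`/`quo` is reused).
-/

noncomputable section

-- single-problem summit: the doubled namespace component `ResolutionOfSingularities` is forced
set_option linter.dupNamespace false

open MvPolynomial

universe u

namespace Summit.ResolutionOfSingularities.ResolutionOfSingularities.Theorems.HomologicalConductor.KC3JacobianFloor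

open Summit.ResolutionOfSingularities.ResolutionOfSingularities.Theorems.HomologicalConductor.KC3Witness
  (e e_apply_zero e_apply_one e_apply_two e_add e_zero e_le_iff e_sub)
open Summit.ResolutionOfSingularities.ResolutionOfSingularities.Theorems.HomologicalConductor.KC3FrobeniusOrder

variable {k : Type u} [Field k] (u : k)

/-! ## The coordinate map `(Fin 6 → A_u) → W₀` and its bijectivity -/

/-- The coordinate map `(Fin 6 → A_u) → W₀`, `f ↦ Σᵢ fᵢ • mᵢ` (`mᵢ` the box monomials). [OURS · L1 w44b] -/
def coordAu : (Fin 6 → ↥(kc3Au u)) →ₗ[↥(kc3Au u)] ↥(kc3W k) where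
  toFun f := ∑ i, f i • boxMonomial k i
  map_add' f g := by
    change ∑ i, (f i + g i) • boxMonomial k i = _
    rw [← Finset.sum_add_distrib]
    exact Finset.sum_congr rfl fun i _ => add_smul _ _ _
  map_smul' p f := by
    change ∑ i, (p * f i) • boxMonomial k i = p • ∑ i, f i • boxMonomial k i
    rw [Finset.smul_sum]
    exact Finset.sum_congr rfl fun i _ => mul_smul _ _ _

/-- Unfolding of the coordinate map. [OURS · bookkeeping] -/
theorem coordAu_apply (f : Fin 6 → ↥(kc3Au u)) : coordAu u f = ∑ i, f i • boxMonomial k i := rfl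

/-- The coordinate map as a polynomial: `↑(Σᵢ fᵢ • mᵢ) = Σᵢ ↑fᵢ · x^{box i}`. [OURS · bookkeeping] -/
theorem coe_coordAu (f : Fin 6 → ↥(kc3Au u)) :
    ((coordAu u f : ↥(kc3W k)) : MvPolynomial (Fin 3) k) =
      ∑ i, (f i : MvPolynomial (Fin 3) k) * monomial (box i) 1 := by
  rw [coordAu_apply, AddSubmonoidClass.coe_finsetSum]
  exact Finset.sum_congr rfl fun i _ => by rw [coe_smul_kc3Au, coe_boxMonomial]

/-- **Linear independence upstairs.** If `Σᵢ θ_u(gᵢ) · x^{box i} = 0` then every `gᵢ = 0`: the top exponent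
`box i + sc q` (`q ∈ supp gᵢ`) of largest `a`-degree carries the coefficient `coeff_q gᵢ ≠ 0` and is hit by no
other term (triangularity + `box n + sc q` injective). [OURS · L1 w44b] -/
theorem eq_zero_of_sum_θu_mul_box_eq_zero (g : Fin 6 → MvPolynomial (Fin 3) k)
    (h : ∑ i, θu k u (g i) * monomial (box i) 1 = 0) : g = 0 := by
  classical
  by_contra hg
  -- the finite set of pairs `(i, q)`, `q ∈ supp gᵢ`, is nonempty
  let S : Finset (Σ _ : Fin 6, Fin 3 →₀ ℕ) := Finset.univ.sigma fun i => (g i).support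
  have hS : S.Nonempty := by
    obtain ⟨i, hi⟩ : ∃ i, g i ≠ 0 := by
      by_contra hall; push Not at hall; exact hg (funext hall)
    obtain ⟨q, hq⟩ := Finset.nonempty_iff_ne_empty.mpr (support_eq_empty.not.mpr hi)
    exact ⟨⟨i, q⟩, Finset.mem_sigma.mpr ⟨Finset.mem_univ _, hq⟩⟩
  -- a pair maximising the `a`-degree of `box i + sc q`
  obtain ⟨⟨i₀, q₀⟩, hmem, hmax⟩ :=
    S.exists_max_image (fun iq => (box iq.1 + sc iq.2) 0) hS
  have hq₀ : q₀ ∈ (g i₀).support := (Finset.mem_sigma.mp hmem).2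
  set D := box i₀ + sc q₀ with hDdef
  -- expand the sum monomial by monomial
  have hexp : ∑ i, θu k u (g i) * monomial (box i) 1 =
      ∑ i, ∑ q ∈ (g i).support, θu k u (monomial q (coeff q (g i))) * monomial (box i) 1 := by
    refine Finset.sum_congr rfl fun i _ => ?_
    conv_lhs => rw [(g i).as_sum, map_sum, Finset.sum_mul]
  -- the `D`-coefficient of the sum is `coeff q₀ (g i₀)`
  have hcoeff : coeff D (∑ i, θu k u (g i) * monomial (box i) 1) = coeff q₀ (g i₀) := by
    rw [hexp, coeff_sum]
    have hterm : ∀ (i : Fin 6) (q : Fin 3 →₀ ℕ), q ∈ (g i).support → (⟨i, q⟩ : Σ _ : Fin 6, Fin 3 →₀ ℕ) ≠ ⟨i₀, q₀⟩ →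
        coeff D (θu k u (monomial q (coeff q (g i))) * monomial (box i) 1) = 0 := by
      intro i q hq hne
      by_contra hne0
      rcases coeff_θu_monomial_mul_box_ne_zero u hne0 with hD | hD
      · apply hne
        have hi : i₀ = i := box_add_sc_injective (hDdef ▸ hD)
        subst hi
        have hsc : sc q₀ = sc q := add_left_cancel (hDdef ▸ hD)
        rw [sc_injective hsc]
      · have := hmax ⟨i, q⟩ (Finset.mem_sigma.mpr ⟨Finset.mem_univ _, hq⟩)
        simp only at this
        omega
    rw [Finset.sum_eq_single i₀]
    · rw [coeff_sum, Finset.sum_eq_single q₀]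
      · exact coeff_θu_monomial_mul_box_top u q₀ _ i₀
      · intro q hq hne
        exact hterm i₀ q hq (fun h => hne (by cases h; rfl))
      · intro h; exact absurd hq₀ h
    · intro i _ hne
      rw [coeff_sum]
      exact Finset.sum_eq_zero fun q hq => hterm i q hq (fun h => hne (by cases h; rfl))
    · intro h; exact absurd (Finset.mem_univ _) h
  rw [h, coeff_zero] at hcoeff
  exact (mem_support_iff.mp hq₀) hcoeff.symm

/-- `θ_u` is injective (the case `g = (p, 0, …, 0)`): `a⁶ + u·abc, b³, c²` are algebraically independent.
[OURS · L1 w44b] -/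
theorem θu_injective : Function.Injective (θu k u) := by
  classical
  rw [injective_iff_map_eq_zero]
  intro p hp
  have h := eq_zero_of_sum_θu_mul_box_eq_zero u (Pi.single 0 p) (by
    rw [Finset.sum_eq_single 0]
    · rw [Pi.single_eq_same, hp, zero_mul]
    · intro i _ hi; rw [Pi.single_eq_of_ne hi, map_zero, zero_mul]
    · intro h; exact absurd (Finset.mem_univ _) h)
  have := congrFun h 0
  rwa [Pi.single_eq_same] at this

/-- The coordinate map `(Fin 6 → A_u) → W₀` is injective. [OURS · L1 w44b] -/
theorem coordAu_injective : Function.Injective (coordAu u) := by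
  classical
  refine (injective_iff_map_eq_zero _).mpr fun f hf => ?_
  choose g hg using fun i => θuA_surjective u (f i)
  have hsum : ∑ i, θu k u (g i) * monomial (box i) 1 = 0 := by
    have := congrArg (fun w : ↥(kc3W k) => (w : MvPolynomial (Fin 3) k)) hf
    simp only [coe_coordAu, ZeroMemClass.coe_zero] at this
    rw [← this]
    exact Finset.sum_congr rfl fun i _ => by rw [← hg i, coe_θuA]
  have hg0 := eq_zero_of_sum_θu_mul_box_eq_zero u g hsum
  funext i
  rw [← hg i, show g i = 0 from congrFun hg0 i, map_zero]
  rfl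

/-- `p • mᵢ` lies in the range of the coordinate map. [OURS · bookkeeping] -/
theorem smul_boxMonomial_mem_range (p : ↥(kc3Au u)) (i : Fin 6) :
    p • boxMonomial k i ∈ LinearMap.range (coordAu u) := by
  classical
  refine ⟨Pi.single i p, ?_⟩
  rw [coordAu_apply, Finset.sum_eq_single i]
  · rw [Pi.single_eq_same]
  · intro j _ hj; rw [Pi.single_eq_of_ne hj, zero_smul]
  · intro h; exact absurd (Finset.mem_univ _) h

/-- **Spanning.** Every lattice monomial lies in `Σᵢ A_u · mᵢ` (induction on the `a`-degree: below `6` it is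
`(b^{3j}c^{2l}) • m_{box}`; from `6` on, `a⁶ = (a⁶ + u·abc) − u·abc` trades `x^d` for `θ_u(A) • x^{d−(6,0,0)}`
and `u • x^{d−(6,0,0)+(1,1,1)}`, both of smaller `a`-degree). [OURS · L1 w44b] -/
theorem monomial_mem_range_coordAu :
    ∀ (N : ℕ) (d : Fin 3 →₀ ℕ) (hd : 6 ∣ wt d), d 0 < N → ∀ c : k,
      (⟨monomial d c, monomial_mem_kc3W hd c⟩ : ↥(kc3W k)) ∈ LinearMap.range (coordAu u) := by
  intro N
  induction N with
  | zero => intro d _ h; exact absurd h (Nat.not_lt_zero _)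
  | succ N ih =>
    intro d hd hdN c
    by_cases h6 : 6 ≤ d 0
    · -- `x^d = a⁶ · x^{d'}`, `d' = d - (6,0,0)`, and `a⁶ = θ_u(A) - u·abc`
      have hd' : 6 ∣ wt (d - e 6 0 0) := by
        have : wt (d - e 6 0 0) + 6 = wt d := by
          simp only [wt, Finsupp.coe_tsub, Pi.sub_apply, e_apply_zero, e_apply_one, e_apply_two]; omega
        omega
      have hd'' : 6 ∣ wt (d - e 6 0 0 + e 1 1 1) := by
        rw [wt_add]; exact dvd_add hd' (by simp [wt])
      have hdecomp : (⟨monomial d c, monomial_mem_kc3W hd c⟩ : ↥(kc3W k)) =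
          θuA u (X 0) • ⟨monomial (d - e 6 0 0) c, monomial_mem_kc3W hd' c⟩ -
            u • ⟨monomial (d - e 6 0 0 + e 1 1 1) c, monomial_mem_kc3W hd'' c⟩ := by
        apply Subtype.ext
        rw [Subalgebra.coe_sub, coe_smul_kc3Au, coe_θuA, θu_X_zero, Subalgebra.coe_smul]
        change monomial d c = _ * monomial (d - e 6 0 0) c - u • monomial (d - e 6 0 0 + e 1 1 1) c
        rw [add_mul, monomial_mul, monomial_mul, one_mul, smul_monomial, smul_eq_mul,
          add_tsub_cancel_of_le (show e 6 0 0 ≤ d from fun i => by fin_cases i <;> simp [h6]),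
          add_comm (e 1 1 1), add_sub_cancel_right]
      rw [hdecomp]
      refine Submodule.sub_mem _ (Submodule.smul_mem _ _ (ih _ hd' ?_ c)) ?_
      · simp only [Finsupp.coe_tsub, Pi.sub_apply, e_apply_zero]; omega
      · rw [← algebraMap_smul (↥(kc3Au u)) u]
        refine Submodule.smul_mem _ _ (ih _ hd'' ?_ c)
        simp only [Finsupp.coe_add, Finsupp.coe_tsub, Pi.add_apply, Pi.sub_apply, e_apply_zero]; omega
    · -- `a`-degree `< 6`: `x^d = (b^{3j} c^{2l}) • m_{box}`
      push Not at h6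
      have hq0 : quo d 0 = 0 := by simp [quo]; omega
      have hθ : θu k u (monomial (quo d) c) = monomial (sc (quo d)) c := by
        rw [θu_monomial, hq0, pow_zero, one_mul,
          show e 0 (3 * quo d 1) (2 * quo d 2) = sc (quo d) from by
            ext i; fin_cases i <;> simp [sc, hq0]]
      have : (⟨monomial d c, monomial_mem_kc3W hd c⟩ : ↥(kc3W k)) =
          θuA u (monomial (quo d) c) • boxMonomial k (boxIdx d) := by
        apply Subtype.ext
        rw [coe_smul_kc3Au, coe_θuA, hθ, coe_boxMonomial, monomial_mul, mul_one, ← rem_eq_box hd,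
          add_comm, rem_add_sc_quo]
      rw [this]
      exact smul_boxMonomial_mem_range u _ _

/-- The coordinate map `(Fin 6 → A_u) → W₀` is surjective: `W₀ = Σᵢ A_u · mᵢ`. [OURS · L1 w44b] -/
theorem coordAu_surjective : Function.Surjective (coordAu u) := by
  classical
  intro w
  obtain ⟨p, hp⟩ := w
  suffices h : (⟨p, hp⟩ : ↥(kc3W k)) ∈ LinearMap.range (coordAu u) by
    obtain ⟨f, hf⟩ := h; exact ⟨f, hf⟩
  have hL := mem_kc3W_iff.mp hp
  have : (⟨p, hp⟩ : ↥(kc3W k)) =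
      ∑ d ∈ p.support.attach, (⟨monomial d.1 (coeff d.1 p), monomial_mem_kc3W (hL d.1 d.2) _⟩ :
        ↥(kc3W k)) := by
    apply Subtype.ext
    rw [AddSubmonoidClass.coe_finsetSum]
    change p = ∑ d ∈ p.support.attach, monomial d.1 (coeff d.1 p)
    rw [Finset.sum_attach p.support (fun d => monomial d (coeff d p))]
    exact as_sum p
  rw [this]
  exact Submodule.sum_mem _ fun d _ => monomial_mem_range_coordAu u _ d.1 (hL d.1 d.2) (Nat.lt_succ_self _) _

/-! ## The basis and the instances -/

/-- **`W₀` is free of rank 6 over `A_u = k[a⁶ + u·abc, b³, c²]` on the box monomials**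
`1, a⁴b, a²b², a³c, abc, a⁵b²c`, for every `u ∈ k`. [OURS · L1 w44b] -/
def kc3BasisAu : Module.Basis (Fin 6) ↥(kc3Au u) ↥(kc3W k) :=
  (Pi.basisFun ↥(kc3Au u) (Fin 6)).map
    (LinearEquiv.ofBijective (coordAu u) ⟨coordAu_injective u, coordAu_surjective u⟩)

/-- The basis vectors are the box monomials. [OURS · L1 w44b] -/
@[simp] theorem kc3BasisAu_apply (n : Fin 6) : kc3BasisAu u n = boxMonomial k n := by
  classical
  rw [kc3BasisAu, Module.Basis.map_apply, Pi.basisFun_apply, LinearEquiv.ofBijective_apply,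
    coordAu_apply, Finset.sum_eq_single n]
  · rw [Pi.single_eq_same, one_smul]
  · intro i _ hi; rw [Pi.single_eq_of_ne hi, zero_smul]
  · intro h; exact absurd (Finset.mem_univ _) h

/-- `W₀` is a free `A_u`-module. [OURS · L1 w44b] -/
instance kc3W.moduleFreeAu : Module.Free ↥(kc3Au u) ↥(kc3W k) := Module.Free.of_basis (kc3BasisAu u)

/-- `W₀` is a finitely generated `A_u`-module. [OURS · L1 w44b] -/
instance kc3W.moduleFiniteAu : Module.Finite ↥(kc3Au u) ↥(kc3W k) := Module.Finite.of_basis (kc3BasisAu u)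

/-- **`k[A,B,C] ≃ₐ[k] A_u`** along `θ_u`. [OURS · L1 w44b] -/
def kc3θuEquiv : MvPolynomial (Fin 3) k ≃ₐ[k] ↥(kc3Au u) := AlgEquiv.ofInjective (θu k u) (θu_injective u)

/-- The underlying polynomial of `kc3θuEquiv u p` is `θ_u p`. [OURS · bookkeeping] -/
@[simp] theorem coe_kc3θuEquiv (p : MvPolynomial (Fin 3) k) :
    (kc3θuEquiv u p : MvPolynomial (Fin 3) k) = θu k u p := rfl

/-- `A_u ≅ k[A,B,C]` is a noetherian ring. [folklore] -/
instance kc3Au.isNoetherianRing : IsNoetherianRing ↥(kc3Au u) :=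
  isNoetherianRing_of_ringEquiv (MvPolynomial (Fin 3) k) (kc3θuEquiv u).toRingEquiv

end Summit.ResolutionOfSingularities.ResolutionOfSingularities.Theorems.HomologicalConductor.KC3JacobianFloor

end
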